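import Summits.CriticalPhenomena.SAWScalingLimit.Theorems.IsingBoundaryRatio.Negative.IsingBoundaryRatioNesting
import Literature.Probability.RandomPlanarGeometry.CaratheodoryHalfPlaneProofs
import Literature.Probability.RandomPlanarGeometry.RestrictionHullsRiemannProofs
import Literature.Probability.RandomPlanarGeometry.RestrictionHullsProofs
import Literature.Probability.RandomPlanarGeometry.HullSubdomainPullback

/-!
# Negative-side results for the crux `SAWLoopFugacityFlow.IsingBoundaryRatio` (stmt-CriticalPhenomena-10650):
CONFORMAL SIDE — the normalisations `IsRestrictionMap` / `HasRestrictionDeriv` are LOAD-BEARING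
(delete either and the statement is contradictory already on the diagonal `D' = D`: dilations
`z ↦ z`, `z ↦ 4z` of `ℍₒ`, resp. `d = 1, 4`, give two limits `1 ≠ 2`); what the hypotheses pin
down (`A = ∅ ⇒ d = 1`; the ε-ball clause ⇒ `IsHullSubdomain`; `A ∈ 𝒬*` and `d = Φ'_A(0) ∈ (0,1]`,
so the claimed limit `d^{1/2} ∈ (0,1]` is GKS-admissible); and THE DIAGONAL `D' = D` OF THE CRUX
IS A THEOREM (`crux_diag`: ratio eventually `≡ 1 = d^{1/2}`) — a refutation must be off-diagonal
and quantitative (work-file §4–§6).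

Refuter `cdisprove` (standing adversary); the full indexed work file is
`Summits/CriticalPhenomena/SAWScalingLimit/Cruxes/IsingBoundaryRatio/Disproof.lean`.
-/

noncomputable section

open scoped Classical symmDiff
open MeasureTheory Filter Topology Set Function
open Literature.Probability.LatticeModels Literature.Probability.RandomPlanarGeometry
open UpperHalfPlane (upperHalfPlaneSet)

namespace Summit.CriticalPhenomena.SAWScalingLimit.Theorems.IsingBoundaryRatio.Negative

open Summit.CriticalPhenomena.SAWScalingLimit.Theses.SAWLoopFugacityFlow (IsingBoundaryRatio)

/-! ## §4 Load-bearing normalisations: without `IsRestrictionMap` / `HasRestrictionDeriv` the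
statement is contradictory already on the diagonal `D' = D` -/

/-- The pulled-back hull of `D` itself is empty: `closure (ℍ ∖ φ⁻¹ D) = ∅`. [folklore] -/
theorem hull_self_eq_empty (D : DobrushinDomain) (φ : ConformalEquiv upperHalfPlaneSet D.carrier) :
    closure (upperHalfPlaneSet \ {z | z ∈ upperHalfPlaneSet ∧ φ z ∈ D.carrier}) = ∅ := by
  have : {z | z ∈ upperHalfPlaneSet ∧ φ z ∈ D.carrier} = upperHalfPlaneSet := by
    ext z
    exact ⟨fun hz => hz.1, fun hz => ⟨hz, φ.mapsTo hz⟩⟩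
  rw [this, _root_.sdiff_self, Set.bot_eq_empty, closure_empty]

/-- The dilation `z ↦ c z` of `ℍₒ` viewed as a conformal equivalence `ℍₒ ∖ ∅ → ℍₒ`. -/
def smulEmpty (c : ℝ) (hc : 0 < c) : ConformalEquiv (upperHalfPlaneSet \ ∅) upperHalfPlaneSet :=
  (ConformalEquiv.smulUpperHalfPlane c hc).copy _ _ sdiff_empty rfl

/-- Auxiliary fact for the negative-side analysis of `IsingBoundaryRatio` (see the module docstring). [folklore] -/
@[simp] theorem smulEmpty_apply (c : ℝ) (hc : 0 < c) (z : ℂ) : smulEmpty c hc z = c • z := rfl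

/-- `z ↦ c z` has "restriction derivative" `c` at `0` for the empty hull. [folklore] -/
theorem hasRestrictionDeriv_smulEmpty (c : ℝ) (hc : 0 < c) : HasRestrictionDeriv ∅ (smulEmpty c hc) c := by
  unfold HasRestrictionDeriv
  refine (tendsto_const_nhds (x := ((c : ℝ) : ℂ))).congr' ?_
  filter_upwards [self_mem_nhdsWithin] with z hz
  have hz0 : z ≠ 0 := by
    rintro rfl
    exact absurd hz.1 (by simp [upperHalfPlaneSet])
  rw [smulEmpty_apply, Complex.real_smul, mul_div_assoc, div_self hz0, mul_one]

/-- Auxiliary fact for the negative-side analysis of `IsingBoundaryRatio` (see the module docstring). [folklore] -/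
theorem one_rpow_half_ne_four_rpow_half : (1 : ℝ) ^ ((1 : ℝ) / 2) ≠ (4 : ℝ) ^ ((1 : ℝ) / 2) := by
  rw [Real.one_rpow, show (4 : ℝ) = 2 ^ (2 : ℝ) by norm_num, ← Real.rpow_mul (by norm_num)]
  norm_num

/-- The crux with `IsRestrictionMap A Φ` deleted. -/
def WithoutIsRestrictionMap : Prop :=
  ∀ (D D' : DobrushinDomain) (a b : ℝ → Site 2), SAW.IsEndpointApprox D a b →
    SAW.IsEndpointApprox D' a b → D'.carrier ⊆ D.carrier → D'.pt 0 = D.pt 0 → D'.pt 1 = D.pt 1 →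
    (∃ ε : ℝ, 0 < ε ∧ D'.carrier ∩ Metric.ball (D.pt 0) ε = D.carrier ∩ Metric.ball (D.pt 0) ε ∧
      D'.carrier ∩ Metric.ball (D.pt 1) ε = D.carrier ∩ Metric.ball (D.pt 1) ε) →
    ∀ (φ : ConformalEquiv upperHalfPlaneSet D.carrier), D.IsChordalUniformizing φ →
    ∀ (A : Set ℂ), A = closure (upperHalfPlaneSet \ {z | z ∈ upperHalfPlaneSet ∧ φ z ∈ D'.carrier}) →
    ∀ (Φ : ConformalEquiv (upperHalfPlaneSet \ A) upperHalfPlaneSet) (d : ℝ),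
    HasRestrictionDeriv A Φ d →
    Tendsto (ratio D D' a b) (𝓝[>] 0) (𝓝 (d ^ ((1 : ℝ) / 2)))

/-- ANY PROOF MUST USE `IsRestrictionMap`: without it, on the diagonal `D' = D` (hull `A = ∅`) the
dilations `z ↦ z` and `z ↦ 4z` are both admissible `Φ`, with `d = 1` and `d = 4`, and the ratio
would have the two limits `1 ≠ 2`. Witness: `D = D' =` unit disc, any endpoint approximation
(`SAW.exists_isEndpointApprox`), any chordal uniformizer (`exists_isChordalUniformizing_holds`). [folklore] -/
theorem isingBoundaryRatio_false_without_IsRestrictionMap : ¬ WithoutIsRestrictionMap := by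
  intro h
  set D := DobrushinDomain.unitDisc
  obtain ⟨a, b, hab⟩ := SAW.exists_isEndpointApprox D
  obtain ⟨φ, hφ⟩ := MarkedDomain.exists_isChordalUniformizing_holds D
  have hε : ∃ ε : ℝ, 0 < ε ∧ D.carrier ∩ Metric.ball (D.pt 0) ε = D.carrier ∩ Metric.ball (D.pt 0) ε ∧
      D.carrier ∩ Metric.ball (D.pt 1) ε = D.carrier ∩ Metric.ball (D.pt 1) ε := ⟨1, one_pos, rfl, rfl⟩
  have hA : (∅ : Set ℂ) = closure (upperHalfPlaneSet \ {z | z ∈ upperHalfPlaneSet ∧ φ z ∈ D.carrier}) :=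
    (hull_self_eq_empty D φ).symm
  have h1 := h D D a b hab hab subset_rfl rfl rfl hε φ hφ ∅ hA (smulEmpty 1 one_pos) 1
    (hasRestrictionDeriv_smulEmpty 1 one_pos)
  have h4 := h D D a b hab hab subset_rfl rfl rfl hε φ hφ ∅ hA (smulEmpty 4 (by norm_num)) 4
    (hasRestrictionDeriv_smulEmpty 4 (by norm_num))
  exact one_rpow_half_ne_four_rpow_half (tendsto_nhds_unique h1 h4)

/-- The crux with `HasRestrictionDeriv A Φ d` deleted (so `d` is a free real parameter). -/
def WithoutHasRestrictionDeriv : Prop :=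
  ∀ (D D' : DobrushinDomain) (a b : ℝ → Site 2), SAW.IsEndpointApprox D a b →
    SAW.IsEndpointApprox D' a b → D'.carrier ⊆ D.carrier → D'.pt 0 = D.pt 0 → D'.pt 1 = D.pt 1 →
    (∃ ε : ℝ, 0 < ε ∧ D'.carrier ∩ Metric.ball (D.pt 0) ε = D.carrier ∩ Metric.ball (D.pt 0) ε ∧
      D'.carrier ∩ Metric.ball (D.pt 1) ε = D.carrier ∩ Metric.ball (D.pt 1) ε) →
    ∀ (φ : ConformalEquiv upperHalfPlaneSet D.carrier), D.IsChordalUniformizing φ →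
    ∀ (A : Set ℂ), A = closure (upperHalfPlaneSet \ {z | z ∈ upperHalfPlaneSet ∧ φ z ∈ D'.carrier}) →
    ∀ (Φ : ConformalEquiv (upperHalfPlaneSet \ A) upperHalfPlaneSet) (d : ℝ),
    IsRestrictionMap A Φ →
    Tendsto (ratio D D' a b) (𝓝[>] 0) (𝓝 (d ^ ((1 : ℝ) / 2)))

/-- ANY PROOF MUST USE `HasRestrictionDeriv`: it is the only clause mentioning `d`; without it the
conclusion is claimed for `d = 1` and `d = 4` at once (diagonal `D' = D`, `Φ = id`). [folklore] -/
theorem isingBoundaryRatio_false_without_HasRestrictionDeriv : ¬ WithoutHasRestrictionDeriv := by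
  intro h
  set D := DobrushinDomain.unitDisc
  obtain ⟨a, b, hab⟩ := SAW.exists_isEndpointApprox D
  obtain ⟨φ, hφ⟩ := MarkedDomain.exists_isChordalUniformizing_holds D
  have hε : ∃ ε : ℝ, 0 < ε ∧ D.carrier ∩ Metric.ball (D.pt 0) ε = D.carrier ∩ Metric.ball (D.pt 0) ε ∧
      D.carrier ∩ Metric.ball (D.pt 1) ε = D.carrier ∩ Metric.ball (D.pt 1) ε := ⟨1, one_pos, rfl, rfl⟩
  have hA : (∅ : Set ℂ) = closure (upperHalfPlaneSet \ {z | z ∈ upperHalfPlaneSet ∧ φ z ∈ D.carrier}) :=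
    (hull_self_eq_empty D φ).symm
  have h1 := h D D a b hab hab subset_rfl rfl rfl hε φ hφ ∅ hA restrictionMapEmpty 1 isRestrictionMap_empty
  have h4 := h D D a b hab hab subset_rfl rfl rfl hε φ hφ ∅ hA restrictionMapEmpty 4 isRestrictionMap_empty
  exact one_rpow_half_ne_four_rpow_half (tendsto_nhds_unique h1 h4)

/-! ## §5 Conformal side: what the hypotheses pin down -/

/-- On the diagonal the restriction data are forced: `IsRestrictionMap ∅ Φ` and
`HasRestrictionDeriv ∅ Φ d` imply `d = 1` (uniqueness of `Φ_∅ = id`, tree theorem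
`IsStarHull.existsUnique_isRestrictionMap_holds`). [folklore] -/
theorem deriv_eq_one_of_empty {Φ : ConformalEquiv (upperHalfPlaneSet \ ∅) upperHalfPlaneSet} {d : ℝ}
    (hΦ : IsRestrictionMap ∅ Φ) (hd : HasRestrictionDeriv ∅ Φ d) : d = 1 := by
  obtain ⟨Φ₀, -, huniq⟩ := IsStarHull.existsUnique_isRestrictionMap_holds isStarHull_empty
  have h1 : EqOn Φ Φ₀ (upperHalfPlaneSet \ ∅) := huniq Φ hΦ
  have h2 : EqOn restrictionMapEmpty Φ₀ (upperHalfPlaneSet \ ∅) := huniq _ isRestrictionMap_empty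
  haveI : (𝓝[upperHalfPlaneSet \ ∅] (0 : ℂ)).NeBot :=
    mem_closure_iff_nhdsWithin_neBot.1 isStarHull_empty.zero_mem_closure_diff
  have hconst : Tendsto (fun z => Φ z / z) (𝓝[upperHalfPlaneSet \ ∅] 0) (𝓝 ((1 : ℝ) : ℂ)) := by
    refine (tendsto_const_nhds (x := ((1 : ℝ) : ℂ))).congr' ?_
    filter_upwards [self_mem_nhdsWithin] with z hz
    have hz0 : z ≠ 0 := by
      rintro rfl
      exact absurd hz.1 (by simp [upperHalfPlaneSet])
    rw [h1 hz, ← h2 hz, restrictionMapEmpty_apply, Complex.ofReal_one, div_self hz0]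
  exact_mod_cast tendsto_nhds_unique hd hconst

/-- The ε-ball agreement of the crux makes `D'` a hull subdomain of `D` in the sense of
`MarkedDomain.IsHullSubdomain` (LSW's `A ∈ 𝒬*` transposed). [folklore] -/
theorem isHullSubdomain_of_conds {D D' : DobrushinDomain} (hsub : D'.carrier ⊆ D.carrier)
    (h0 : D'.pt 0 = D.pt 0) (h1 : D'.pt 1 = D.pt 1)
    (hε : ∃ ε : ℝ, 0 < ε ∧ D'.carrier ∩ Metric.ball (D.pt 0) ε = D.carrier ∩ Metric.ball (D.pt 0) ε ∧
      D'.carrier ∩ Metric.ball (D.pt 1) ε = D.carrier ∩ Metric.ball (D.pt 1) ε) :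
    D.IsHullSubdomain D' := by
  obtain ⟨ε, hε, hb0, hb1⟩ := hε
  have key : ∀ p : ℂ, D'.carrier ∩ Metric.ball p ε = D.carrier ∩ Metric.ball p ε →
      p ∉ closure (D.carrier \ D'.carrier) := by
    intro p hp hcl
    rw [Metric.mem_closure_iff] at hcl
    obtain ⟨z, ⟨hzD, hzD'⟩, hdist⟩ := hcl ε hε
    have hz : z ∈ D.carrier ∩ Metric.ball p ε := ⟨hzD, by rwa [Metric.mem_ball, dist_comm]⟩
    rw [← hp] at hz
    exact hzD' hz.1
  exact ⟨hsub, h0, h1, key _ hb0, key _ hb1⟩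

/-- Under the crux hypotheses the pulled-back set `A` IS a `*`-hull and `d` IS the derivative
`Φ'_A(0) ∈ (0, 1]` (tree theorems `IsStarHull.pullbackHull`, `exists_hasRestrictionDeriv_holds`,
uniqueness). So the hypotheses on `(φ, A, Φ, d)` are satisfiable for every hull subdomain and pin
`d` uniquely: the crux is neither vacuous nor over-determined in its conformal variables. [folklore] -/
theorem starHull_and_deriv_mem {D D' : DobrushinDomain} (hsub : D'.carrier ⊆ D.carrier)
    (h0 : D'.pt 0 = D.pt 0) (h1 : D'.pt 1 = D.pt 1)
    (hε : ∃ ε : ℝ, 0 < ε ∧ D'.carrier ∩ Metric.ball (D.pt 0) ε = D.carrier ∩ Metric.ball (D.pt 0) ε ∧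
      D'.carrier ∩ Metric.ball (D.pt 1) ε = D.carrier ∩ Metric.ball (D.pt 1) ε)
    {φ : ConformalEquiv upperHalfPlaneSet D.carrier} (hφ : D.IsChordalUniformizing φ) {A : Set ℂ}
    (hA : A = closure (upperHalfPlaneSet \ {z | z ∈ upperHalfPlaneSet ∧ φ z ∈ D'.carrier}))
    {Φ : ConformalEquiv (upperHalfPlaneSet \ A) upperHalfPlaneSet} {d : ℝ}
    (hΦ : IsRestrictionMap A Φ) (hd : HasRestrictionDeriv A Φ d) :
    IsStarHull A ∧ 0 < d ∧ d ≤ 1 := by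
  have hHull := isHullSubdomain_of_conds hsub h0 h1 hε
  have hstar : IsStarHull A := by
    rw [hA]
    exact IsStarHull.pullbackHull JordanDomain.isSimplyConnected_holds hφ hHull
  obtain ⟨d₀, hd₀, hd₀1, hd₀'⟩ := IsStarHull.exists_hasRestrictionDeriv_holds hstar hΦ
  have : d = d₀ := hd.unique hstar hd₀'
  subst this
  exact ⟨hstar, hd₀, hd₀1⟩

/-- The claimed limit is in the GKS-admissible range. [folklore] -/
theorem claimedLimit_mem_Ioc {d : ℝ} (hd : 0 < d) (hd1 : d ≤ 1) :
    d ^ ((1 : ℝ) / 2) ∈ Ioc (0 : ℝ) 1 :=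
  ⟨Real.rpow_pos_of_pos hd _, Real.rpow_le_one hd.le hd1 (by norm_num)⟩

/-! ## §6 The diagonal `D' = D` is TRUE -/

/-- THE DIAGONAL OF THE CRUX IS A THEOREM: for `D' = D` every admissible `(φ, A, Φ, d)` has `A = ∅`,
`d = 1`, and the ratio tends to `1 = d^{1/2}`. (The statement is correctly normalised; a
refutation must be off-diagonal, i.e. must COMPUTE a non-trivial `Φ'_A(0)` against Ising
asymptotics — beyond any finite/decidable check.) [folklore] -/
theorem crux_diag (D : DobrushinDomain) (a b : ℝ → Site 2) (hab : SAW.IsEndpointApprox D a b)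
    (φ : ConformalEquiv upperHalfPlaneSet D.carrier) (A : Set ℂ)
    (hA : A = closure (upperHalfPlaneSet \ {z | z ∈ upperHalfPlaneSet ∧ φ z ∈ D.carrier}))
    (Φ : ConformalEquiv (upperHalfPlaneSet \ A) upperHalfPlaneSet) (d : ℝ)
    (hΦ : IsRestrictionMap A Φ) (hd : HasRestrictionDeriv A Φ d) :
    Tendsto (ratio D D a b) (𝓝[>] 0) (𝓝 (d ^ ((1 : ℝ) / 2))) := by
  have hA0 : A = ∅ := hA.trans (hull_self_eq_empty D φ)
  subst hA0
  have hd1 : d = 1 := deriv_eq_one_of_empty hΦ hd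
  subst hd1
  rw [Real.one_rpow]
  exact (tendsto_const_nhds (x := (1 : ℝ))).congr' (eventually_ratio_self hab).symm

end Summit.CriticalPhenomena.SAWScalingLimit.Theorems.IsingBoundaryRatio.Negative
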